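import Summits.QuantumFields.YangMills.Theorems.UnitScaleTiltProp7H128OfCrit127Family
import Summits.QuantumFields.YangMills.Theorems.UnitScaleTiltProp7ChartConjPInvT3
import Summits.QuantumFields.YangMills.Theorems.UnitScaleTiltProp7CmapTwSymInputs
import Summits.QuantumFields.YangMills.Theorems.UnitScaleTiltProp7SectET3WCurrentProp4RowsT3
import Summits.QuantumFields.YangMills.Theorems.UnitScaleTiltProp7RCOfRowsFamily
import HarnessLib

/-!
# Route `UnitScaleTilt`, crux «MinimiserStabilityRegPr» (stmt-QuantumFields-19200, stub EX), route (α) — **«HCHART-FAMILY-AT-RECORD»: THE CHART-CONJUGACY ROW `hchart` OF ★px16's H128 DOORS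
# (✓p681225 :225 ∕ ✓p686481) AND OF ★px21's HCRIT93 DOOR (✓p687039), AT THE LETTERS OF RECORD `Wf :=` the (W-X′) letter, `Tcf := T47 H̃ᴾ C̃ (εC L)`, AS A FAMILY THEOREM**
# (EX namer ★w2-19200 g7 WORD (22) 2026-08-29T01:39Z «HZ84-FAMILY + HCHART-FAMILY GO … ⟸ ✓p679214 under the (G22) rows (display whatever regime∕B13 row is not yet a theorem, in its own currency)»).

Cell `ym3-torus` (HUMAN RULING D-0037, YM ladder rung R3 — YM₃ on T³, NOT d = 4, NOT Clay; YM gap NOT proved), width seat `ym3-torus-px21` (gen 4).  THEOREMS ONLY (0 `def`, 0 `sorry`);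
`--supports stmt-QuantumFields-19200 --as helper`, count-neutral; NOT a display change by itself; nothing of the stub ∕ crux ∕ gap claimed.

THE PRINT.  [Balaban1985Variational] (47)–(49) p.285 (the chart `A′ ↦ A′ − HD(A′)`, `D` the fixed point of (48)), (55) p.286, (112) p.294: near `t = 0` the (115)-level chart `T47 H̃ᴾ C̃ εC` of lit's
(84)-expansion, read back on the bonds at the exponent scale `κ_f = η·i`, IS the EX display's pinv chart `χᴾ X = X − H46ᴾ(D^fix X)` — ★px21 ✓`Prop7ChartConjPInv.eventually_smul_iota_T47_eq_chart_pinv`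
((G22)ᴾ).  Its (G22) rows are THEOREMS at the letters of record: the two B13 contraction regimes `hC` (★w5∕px3 ✓`Prop7CmapTwSymInputs.inputs_CmapTwS` — Prop. 3-tw at a printed-regular background —
`.quadAnalytic`, radius `e·η∕2`) and `hC′` (★px3 ✓`prop4Hyp_CmapTwS_conj_zeroJet` `.quadAnalytic`, radius `e∕2`), the Sect. C regime `RC` (★px14 ✓p682625, binder `hRC`), the (46)₀ bound of
`H46ᴾ` (`h46₀`, generic `BH`, fed by ✓`h46_rows_of_norm115`); the η-bookkeeping `9·(40M₀∕(eη)²)·(B_Hη)·(ηε′) = 9·(40M₀∕e²)·B_H·ε′` (`hq47`), `3ηε′ ≤ eη∕2` (`hR6`), `4C₂′ε′² = 4C₂ˢ(ηε′)²`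
(`hnest` with EQUALITY), and the sizes of `A′ = A₁ + H₁B̃` (`norm_H₁` ∘ ✓`bound20_symLog_of_closeAvg`, `hrα hr4 hrε2`).  ONE NEW L-only window is displayed: `hwinC : 4·C₂ᵣ·B₀·ε′² ≤ εC`
((G22)ᴾ's `hwin` — the pinv chart's correction on the `ε′`-ball stays inside the `εC`-ball of lit's `Emap`; jointly satisfiable with `hq47 hR6 hrε2 hselfC hcontrC hdomC`: `4C₂ᵣB₀ε′² < (4∕9)ε′`).

WHAT IS PROVED (ns `…Theorems.Prop7HChartFamilyAtRecord`): ★★★`hchart_family_at_record` — CONCLUSION = ✓p681225's `hchart` binder (:225–253) with `Wf L i U₀ ↦` the W80 letter of record,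
`Tcf L i U₀ ↦ T47 H̃ᴾ C̃ (εC L)`; HYPOTHESES = `norm_H₁ hrα hr4` (S16ᴰ), `BH hBH0 h46₀ ef hef hWe hWε ε′ hq47 hR6 hrε2` (✓p681225 VERBATIM), `hq47₀` (S16ᴰ's `hq47` VERBATIM), `hwinC` (NEW), `hRC`
(✓p682625's conclusion VERBATIM).
HONEST SCOPE.  Composition by name; no estimate of [B11] Sect. C is proved here; not a proof of the stub.

References: T. Bałaban, CMP **102** (1985) 277–309 [Balaban1985Variational] ((44)–(49) p.285, (55) p.286, Prop. 3 p.289, (80) p.290, (112) p.294, Prop. 6 p.295, (117)–(121) p.295, (5) p.278);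
CMP **99** (1985) 389–434 [Balaban1985BackgroundPropagators] ((3.126) p.420, Thm 3.12 (3.133) p.422); CMP **116** (1988) 1–22 [Balaban1988RG2Cluster] (p.5 after (1.13)).
-/

set_option autoImplicit false
noncomputable section
open scoped InnerProductSpace BigOperators Matrix.Norms.L2Operator Matrix Topology

namespace Summit.QuantumFields.YangMills.Theorems.Prop7HChartFamilyAtRecord

open NormedSpace
open Literature.MathematicalPhysics.QuantumFieldTheory.Balaban1983to89
open Literature.MathematicalPhysics.QuantumFieldTheory.Balaban1983to89.T3ContinuumYM3Torus
open Literature.MathematicalPhysics.QuantumFieldTheory.Balaban1983to89.T3UnitLawDensityEML (ℰp)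
open Literature.MathematicalPhysics.QuantumFieldTheory.Balaban1983to89.T3TiltDescent (descendTo)
open Literature.MathematicalPhysics.QuantumFieldTheory.Balaban1983to89.T3PrintedRegularMinimiser (RegPr)
open Literature.MathematicalPhysics.QuantumFieldTheory.Balaban1983to89.T3PrintedMinimiserExistence (regPr_mono)
open Literature.MathematicalPhysics.QuantumFieldTheory.Balaban1983to89.T3Thm1Carrier
open Literature.MathematicalPhysics.QuantumFieldTheory.Balaban1983to89.T3SectALandauChart (In19 emb15 CloseAvg eta)
open B9SectCLatticeCarrier (Bond)
open B9Eq311L2Pairing (WL2)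
open B11Eq115Space (NegSup NegSize Space115 JetSup)
open B11Eq111FrakG (nabla115)
open B11Eq98CurrentSlot (Jcur)
open B11Eq103H1Complex (BondL2K funEquiv)
open B11Eq90Transpose (pair27)
open B11Eq90V0primeCurrent (Tsh Ucur curL flat115)
open B11Eq90V0GroupComposed (T47)
open B11Eq80Current (W80)
open B11Eq174Chart (Regime)
open B11Eq98V0primeCurrentSlots (rieszτ)
open B9Eq3119DeltaPiCarrier (currentCLM)
open B9Eq39Adjoint (prodCfg)
open B9Eq31ActionZpow (actionZ)
open B11Prop3Model (Dfix)
open B13Contraction113 (QuadAnalytic)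
open MatrixLog (mlog)
open Summit.QuantumFields.YangMills.Theorems.Prop7TPrint (expHermField)
open Summit.QuantumFields.YangMills.Theorems.Prop7SPrint (IsLandauPrintS)
open Summit.QuantumFields.YangMills.Theorems.Prop7SectET3Transport (periodsT3 bgOfCfg bondEquiv)
open Summit.QuantumFields.YangMills.Theorems.Prop7SectET3HilbertLetters (W₂ frobEquiv toL2)
open Summit.QuantumFields.YangMills.Theorems.Prop7SectET3CurvedPropagators (Qk H1f frakGfR)
open Summit.QuantumFields.YangMills.Theorems.Prop7SectET3WilsonHessian (DeltaEtaSlot)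
open Summit.QuantumFields.YangMills.Theorems.Prop7SectET3DeltaOnePInv (TJSlotP DeltaOnePJ)
open Summit.QuantumFields.YangMills.Theorems.Prop7SectET3DeltaPiPInv (DeltaPiSlotP H46P)
open Summit.QuantumFields.YangMills.Theorems.Prop7SymAvgTwSym (QTwS CmapTwS)
open Summit.QuantumFields.YangMills.Theorems.Prop7Bound20SymLog (bound20_symLog_of_closeAvg)
open Summit.QuantumFields.YangMills.Theorems.Prop7StubEXOfChartPiecesTwL (windows_of_admissible three_le_memberL)
open Summit.QuantumFields.YangMills.Theorems.Prop7StubEXOfChartPiecesTwS (windows_of_W)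
open Summit.QuantumFields.YangMills.Theorems.Prop7ChartDatumSplit (norm_jetRead_le)
open Summit.QuantumFields.YangMills.Theorems.Prop7ChartConjPInv (eventually_smul_iota_T47_eq_chart_pinv)
open Summit.QuantumFields.YangMills.Theorems.Prop7CmapTwSymInputs (inputs_CmapTwS)
open Summit.QuantumFields.YangMills.Theorems.Prop7SectET3WCurrentProp4Rows (prop4Hyp_CmapTwS_conj_zeroJet)

set_option maxHeartbeats 400000 in -- HEARTBEAT BUDGET rule (cell README): ~30-binder family context + (G22) reader rewrites; line-neutral, decl-local
/-- ★★★ **THE CHART-CONJUGACY ROW `hchart` AT THE LETTERS OF RECORD, FAMILY SHAPE**: for every member, every printed-regular `U₀ ∈ 𝔅_k(V)` of radius `L³·3L·ε₁ ≤ α`, every (111)-solution `A₁`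
in the `r`-ball and every direction `δ′`, EVENTUALLY along the ray `A′ + tδ′` (`A′ = A₁ + H₁B̃`): `κ_f • ι(T47 H̃ᴾ C̃ εC (A′ + tδ′)) = (κ_f•(ιA₁ + ιH₁B̃) + t•κ_f•ιδ′) − H46ᴾ(D^fix(CmapTwS U₀) H46ᴾ C₂ˢ (…))`
— ✓p681225's `hchart` binder with `Wf`, `Tcf` := the letters of record (★px21 ✓`eventually_smul_iota_T47_eq_chart_pinv` under (G22) rows that are theorems + ONE new window `hwinC`).
[cite: Balaban1985Variational, (44)-(49) p.285, (55) p.286, Prop. 3 p.289, (80) p.290, (112) p.294, Prop. 6 p.295, (117)-(121) p.295, (5) p.278; Balaban1985BackgroundPropagators, (3.126) p.420, (3.133) p.422; Balaban1988RG2Cluster, p.5] -/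
theorem hchart_family_at_record
    [hFL : ∀ F : T3Family, Fact (0 < (F.L : ℝ))] [hFη : ∀ (F : T3Family) (k : ℕ), Fact (0 < ((F.L : ℝ)⁻¹) ^ k)]
    (B₀ a₃ α r : ℕ → ℝ) (hB₀ : ∀ L, 1 < L → 0 < B₀ L) (hα : ∀ L, 1 < L → 0 < α L)
    (c₀ cB : ℕ → ℝ) [hc₀ : ∀ L : ℕ, Fact (0 < c₀ L)] [hcB : ∀ L : ℕ, Fact (0 < cB L)]
    (a : ∀ L : ℕ, Idx L → ℝ)
    -- the Prop-3 chart radius of the (W-X′) letter of record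
    (εC : ℕ → ℝ)
    -- the displayed N06 letter row `norm_H₁` at `Δ₁ᴾ` (S16ᴰ VERBATIM; sizes `‖H₁B̃‖ ≤ 2B₀α`)
    (norm_H₁ : ∀ (L : ℕ), 1 < L → ∀ (i : Idx L) (ρ : ℝ) (U₀ : GaugeField (i.1.1.P i.1.2.2) 0 (Matrix.specialUnitaryGroup (Fin 2) ℂ)),
      RegPr i.1.1 i.1.2.1 i.1.2.2 ρ U₀ → ρ ≤ α L → ∀ b, ‖H1f i.1.1 i.1.2.1 i.1.2.2 i.2.2.le (c₀ L) (cB L) (a L i) (DeltaOnePJ i.1.1 i.1.2.1 i.1.2.2 i.2.2.le (c₀ L) (cB L) (a L i)) U₀ b‖ ≤ B₀ L * ‖b‖)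
    -- the radius windows `2B₀α ≤ r`, `4r ≤ a₃` (S16ᴰ VERBATIM) and the (46)₀ bound of the pinv chart letter `H46ᴾ` (✓p681225 :100–102 VERBATIM, generic `BH`)
    (hrα : ∀ L : ℕ, 1 < L → 2 * B₀ L * α L ≤ r L) (hr4 : ∀ L : ℕ, 1 < L → 4 * r L ≤ a₃ L)
    (BH : ℕ → ℝ) (hBH0 : ∀ L : ℕ, 1 < L → 0 ≤ BH L)
    (h46₀ : ∀ (L : ℕ), 1 < L → ∀ (i : Idx L) (U₀ : GaugeField (i.1.1.P i.1.2.2) 0 (Matrix.specialUnitaryGroup (Fin 2) ℂ)), RegPr i.1.1 i.1.2.1 i.1.2.2 (α L) U₀ →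
      ∀ Y, ‖H46P i.1.1 i.1.2.1 i.1.2.2 i.2.2.le (c₀ L) (cB L) (a L i) U₀ Y‖ ≤ BH L * eta i.1.1 i.1.2.1 i.1.2.2 * ‖Y‖)
    (ef : ℕ → ℝ) (hef : ∀ L, 1 < L → 0 < ef L)
    (hWe : ∀ L : ℕ, 1 < L → 10 ^ 9 * (L : ℝ) ^ 2 * ef L ≤ 1) (hWε : ∀ L : ℕ, 1 < L → 10 ^ 12 * (L : ℝ) ^ 3 * α L ≤ 1)
    (ε' : ℕ → ℝ) (hq47 : ∀ L : ℕ, 1 < L → 9 * (40 * (2 * (3 * (2 * ef L + 2700 * (L : ℝ) * α L))) / ef L ^ 2) * BH L * ε' L < 1)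
    (hR6 : ∀ L : ℕ, 1 < L → 6 * ε' L ≤ ef L)
    (hrε2 : ∀ L : ℕ, 1 < L → 2 * (r L + 2 * B₀ L * α L) ≤ ε' L)
    -- the same (51)-window at `B₀` (S16ᴰ's `hq47` VERBATIM) for the Sect. C side, and ONE NEW L-only nesting window «the pinv chart's image of the `ε′`-ball stays in the `εC`-ball» ((G22)ᴾ `hwin`)
    (hq47₀ : ∀ L : ℕ, 1 < L → 9 * (40 * (2 * (3 * (2 * ef L + 2700 * (L : ℝ) * α L))) / ef L ^ 2) * B₀ L * ε' L < 1)
    (hwinC : ∀ L : ℕ, 1 < L → 4 * (40 * (2 * (3 * (2 * ef L + 2700 * (L : ℝ) * α L))) / ef L ^ 2) * B₀ L * ε' L ^ 2 ≤ εC L)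
    -- ROW `hRC` — the Sect. C regime of `(H̃ᴾ, C̃)` at `bH := B₀` (★px14 ✓p682625 `hRC_of_rows_family_B₀`'s conclusion VERBATIM — a THEOREM from `norm_Hπ hεC hdomC hselfC hcontrC`)
    (hRC : ∀ (L : ℕ), 1 < L → ∀ (i : Idx L) (U₀ : GaugeField (i.1.1.P i.1.2.2) 0 (Matrix.specialUnitaryGroup (Fin 2) ℂ)), RegPr i.1.1 i.1.2.1 i.1.2.2 (α L) U₀ →
      Regime (H1f i.1.1 i.1.2.1 i.1.2.2 i.2.2.le (c₀ L) (cB L) (a L i) (DeltaPiSlotP i.1.1 i.1.2.1 i.1.2.2 i.2.2.le (c₀ L) (cB L) (a L i)) U₀) 0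
        (fun A' : Space115 (i.1.1.L : ℝ) (((i.1.1.L : ℝ)⁻¹) ^ (i.1.2.2 - i.1.2.1)) (fun _ : Bond 3 (periodsT3 i.1.1 i.1.2.2) => i.1.2.2 - i.1.2.1)
            (fun _ : Bond 3 (periodsT3 i.1.1 i.1.2.2) × Fin 3 => i.1.2.2 - i.1.2.1) (nabla115 (((i.1.1.L : ℝ)⁻¹) ^ (i.1.2.2 - i.1.2.1)) (bgOfCfg i.1.1 i.1.2.2 U₀)) =>
          (-Complex.I) • CmapTwS i.1.1 i.1.2.1 i.1.2.2 i.2.2.le U₀ (((((eta i.1.1 i.1.2.1 i.1.2.2 : ℝ) : ℂ)) * Complex.I) • (fun b : PBond (i.1.1.P i.1.2.2) 0 => JetSup.equiv _ _ _ A' (bondEquiv i.1.1 i.1.2.2 b))))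
        (B₀ L) 0 (40 * (2 * (3 * (2 * ef L + 2700 * (L : ℝ) * α L))) / ef L ^ 2) (ef L / 2) 0 (a₃ L) (εC L)) :
    ∀ (L : ℕ), 1 < L → ∀ (i : Idx L) (ε₁ : ℝ) (V : GaugeField (i.1.1.P i.1.2.1) 0 (Matrix.specialUnitaryGroup (Fin 2) ℂ))
      (U₀ : GaugeField (i.1.1.P i.1.2.2) 0 (Matrix.specialUnitaryGroup (Fin 2) ℂ)), 0 < ε₁ → PlaqSmall ε₁ V →
      RegPr i.1.1 i.1.2.1 i.1.2.2 ((L : ℝ) ^ 3 * (3 * (L : ℝ)) * ε₁) U₀ → CloseAvg i.1.1 i.1.2.1 i.1.2.2 i.2.2.le ((L : ℝ) ^ 3 * ε₁) V U₀ → (L : ℝ) ^ 3 * (3 * (L : ℝ)) * ε₁ ≤ α L →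
      ∀ A₁ : Space115 (i.1.1.L : ℝ) (((i.1.1.L : ℝ)⁻¹) ^ (i.1.2.2 - i.1.2.1)) (fun _ : Bond 3 (periodsT3 i.1.1 i.1.2.2) => i.1.2.2 - i.1.2.1)
          (fun _ : Bond 3 (periodsT3 i.1.1 i.1.2.2) × Fin 3 => i.1.2.2 - i.1.2.1) (nabla115 (((i.1.1.L : ℝ)⁻¹) ^ (i.1.2.2 - i.1.2.1)) (bgOfCfg i.1.1 i.1.2.2 U₀)),
        ‖A₁‖ < r L →
        A₁ + frakGfR i.1.1 i.1.2.1 i.1.2.2 i.2.2.le (c₀ L) (cB L) (a L i) (DeltaOnePJ i.1.1 i.1.2.1 i.1.2.2 i.2.2.le (c₀ L) (cB L) (a L i)) U₀ (Jcur (bgOfCfg i.1.1 i.1.2.2 U₀)) + frakGfR i.1.1 i.1.2.1 i.1.2.2 i.2.2.le (c₀ L) (cB L) (a L i) (DeltaOnePJ i.1.1 i.1.2.1 i.1.2.2 i.2.2.le (c₀ L) (cB L) (a L i)) U₀ (W80 (rieszτ frobEquiv) (LinearMap.toContinuousLinearMap (Matrix.traceLinearMap (Fin 2) ℂ ℂ))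 (bgOfCfg i.1.1 i.1.2.2 U₀) (H1f i.1.1 i.1.2.1 i.1.2.2 i.2.2.le (c₀ L) (cB L) (a L i) (DeltaPiSlotP i.1.1 i.1.2.1 i.1.2.2 i.2.2.le (c₀ L) (cB L) (a L i)) U₀)
            (fun A' => (-Complex.I) • CmapTwS i.1.1 i.1.2.1 i.1.2.2 i.2.2.le U₀ (((((eta i.1.1 i.1.2.1 i.1.2.2 : ℝ) : ℂ)) * Complex.I) • (fun b : PBond (i.1.1.P i.1.2.2) 0 => JetSup.equiv _ _ _ A' (bondEquiv i.1.1 i.1.2.2 b)))) (εC L) (Jcur (bgOfCfg i.1.1 i.1.2.2 U₀))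
            (currentCLM frobEquiv (fun _ : Bond 3 (periodsT3 i.1.1 i.1.2.2) × Fin 3 => i.1.2.2 - i.1.2.1) (nabla115 (((i.1.1.L : ℝ)⁻¹) ^ (i.1.2.2 - i.1.2.1)) (bgOfCfg i.1.1 i.1.2.2 U₀)) (DeltaEtaSlot i.1.1 i.1.2.1 i.1.2.2 (c₀ L) U₀)) (A₁ + H1f i.1.1 i.1.2.1 i.1.2.2 i.2.2.le (c₀ L) (cB L) (a L i) (DeltaOnePJ i.1.1 i.1.2.1 i.1.2.2 i.2.2.le (c₀ L) (cB L) (a L i)) U₀ (fun c : PBond (i.1.1.P i.1.2.1) 0 =>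
          (-Complex.I) • mlog (((V c : Matrix.specialUnitaryGroup (Fin 2) ℂ) : Matrix (Fin 2) (Fin 2) ℂ)
            * star ((descendTo i.1.1 ℰp i.1.2.1 i.1.2.2 i.2.2.le U₀ c : Matrix.specialUnitaryGroup (Fin 2) ℂ) : Matrix (Fin 2) (Fin 2) ℂ))))) = 0 →
        ∀ δ' : Space115 (i.1.1.L : ℝ) (((i.1.1.L : ℝ)⁻¹) ^ (i.1.2.2 - i.1.2.1)) (fun _ : Bond 3 (periodsT3 i.1.1 i.1.2.2) => i.1.2.2 - i.1.2.1)
          (fun _ : Bond 3 (periodsT3 i.1.1 i.1.2.2) × Fin 3 => i.1.2.2 - i.1.2.1) (nabla115 (((i.1.1.L : ℝ)⁻¹) ^ (i.1.2.2 - i.1.2.1)) (bgOfCfg i.1.1 i.1.2.2 U₀)),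
          (∀ b' : PBond (i.1.1.P i.1.2.2) 0, star (JetSup.equiv _ _ _ δ' (bondEquiv i.1.1 i.1.2.2 b')) = JetSup.equiv _ _ _ δ' (bondEquiv i.1.1 i.1.2.2 b')) →
          (∀ b' : PBond (i.1.1.P i.1.2.2) 0, Matrix.trace (JetSup.equiv _ _ _ δ' (bondEquiv i.1.1 i.1.2.2 b')) = 0) →
          QTwS i.1.1 i.1.2.1 i.1.2.2 i.2.2.le U₀ (fun b' : PBond (i.1.1.P i.1.2.2) 0 => JetSup.equiv _ _ _ δ' (bondEquiv i.1.1 i.1.2.2 b')) = 0 →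
          ∀ᶠ t : ℝ in nhds 0,
            (((eta i.1.1 i.1.2.1 i.1.2.2 : ℝ) : ℂ) * Complex.I) • (fun b' : PBond (i.1.1.P i.1.2.2) 0 => JetSup.equiv _ _ _ (T47 (H1f i.1.1 i.1.2.1 i.1.2.2 i.2.2.le (c₀ L) (cB L) (a L i) (DeltaPiSlotP i.1.1 i.1.2.1 i.1.2.2 i.2.2.le (c₀ L) (cB L) (a L i)) U₀)
            (fun A' => (-Complex.I) • CmapTwS i.1.1 i.1.2.1 i.1.2.2 i.2.2.le U₀ (((((eta i.1.1 i.1.2.1 i.1.2.2 : ℝ) : ℂ)) * Complex.I) • (fun b : PBond (i.1.1.P i.1.2.2) 0 => JetSup.equiv _ _ _ A' (bondEquiv i.1.1 i.1.2.2 b)))) (εC L) ((A₁ + H1f i.1.1 i.1.2.1 i.1.2.2 i.2.2.le (c₀ L) (cB L) (a L i) (DeltaOnePJ i.1.1 i.1.2.1 i.1.2.2 i.2.2.le (c₀ L) (cB L) (a L i)) U₀ (fun c : PBond (i.1.1.P i.1.2.1) 0 =>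
          (-Complex.I) • mlog (((V c : Matrix.specialUnitaryGroup (Fin 2) ℂ) : Matrix (Fin 2) (Fin 2) ℂ)
            * star ((descendTo i.1.1 ℰp i.1.2.1 i.1.2.2 i.2.2.le U₀ c : Matrix.specialUnitaryGroup (Fin 2) ℂ) : Matrix (Fin 2) (Fin 2) ℂ)))) + (t : ℂ) • δ')) (bondEquiv i.1.1 i.1.2.2 b'))
              = (((((eta i.1.1 i.1.2.1 i.1.2.2 : ℝ) : ℂ) * Complex.I) • ((fun b : PBond (i.1.1.P i.1.2.2) 0 => JetSup.equiv _ _ _ A₁ (bondEquiv i.1.1 i.1.2.2 b))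
              + (fun b : PBond (i.1.1.P i.1.2.2) 0 => JetSup.equiv _ _ _ (H1f i.1.1 i.1.2.1 i.1.2.2 i.2.2.le (c₀ L) (cB L) (a L i) (DeltaOnePJ i.1.1 i.1.2.1 i.1.2.2 i.2.2.le (c₀ L) (cB L) (a L i)) U₀ (fun c : PBond (i.1.1.P i.1.2.1) 0 =>
          (-Complex.I) • mlog (((V c : Matrix.specialUnitaryGroup (Fin 2) ℂ) : Matrix (Fin 2) (Fin 2) ℂ)
            * star ((descendTo i.1.1 ℰp i.1.2.1 i.1.2.2 i.2.2.le U₀ c : Matrix.specialUnitaryGroup (Fin 2) ℂ) : Matrix (Fin 2) (Fin 2) ℂ)))) (bondEquiv i.1.1 i.1.2.2 b)))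
                  + (t : ℂ) • ((((eta i.1.1 i.1.2.1 i.1.2.2 : ℝ) : ℂ) * Complex.I) • fun b' : PBond (i.1.1.P i.1.2.2) 0 => JetSup.equiv _ _ _ δ' (bondEquiv i.1.1 i.1.2.2 b')))
                - H46P i.1.1 i.1.2.1 i.1.2.2 i.2.2.le (c₀ L) (cB L) (a L i) U₀ (Dfix (CmapTwS i.1.1 i.1.2.1 i.1.2.2 i.2.2.le U₀) (H46P i.1.1 i.1.2.1 i.1.2.2 i.2.2.le (c₀ L) (cB L) (a L i) U₀) (40 * (2 * (3 * (2 * ef L + 2700 * (i.1.1.L : ℝ) * α L))) / (ef L * eta i.1.1 i.1.2.1 i.1.2.2) ^ 2)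
                    ((((eta i.1.1 i.1.2.1 i.1.2.2 : ℝ) : ℂ) * Complex.I) • ((fun b : PBond (i.1.1.P i.1.2.2) 0 => JetSup.equiv _ _ _ A₁ (bondEquiv i.1.1 i.1.2.2 b))
              + (fun b : PBond (i.1.1.P i.1.2.2) 0 => JetSup.equiv _ _ _ (H1f i.1.1 i.1.2.1 i.1.2.2 i.2.2.le (c₀ L) (cB L) (a L i) (DeltaOnePJ i.1.1 i.1.2.1 i.1.2.2 i.2.2.le (c₀ L) (cB L) (a L i)) U₀ (fun c : PBond (i.1.1.P i.1.2.1) 0 =>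
          (-Complex.I) • mlog (((V c : Matrix.specialUnitaryGroup (Fin 2) ℂ) : Matrix (Fin 2) (Fin 2) ℂ)
            * star ((descendTo i.1.1 ℰp i.1.2.1 i.1.2.2 i.2.2.le U₀ c : Matrix.specialUnitaryGroup (Fin 2) ℂ) : Matrix (Fin 2) (Fin 2) ℂ)))) (bondEquiv i.1.1 i.1.2.2 b)))
                  + (t : ℂ) • ((((eta i.1.1 i.1.2.1 i.1.2.2 : ℝ) : ℂ) * Complex.I) • fun b' : PBond (i.1.1.P i.1.2.2) 0 => JetSup.equiv _ _ _ δ' (bondEquiv i.1.1 i.1.2.2 b'))))) := by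
  intro L hL i ε₁ V U₀ hε₁ hV hreg hclose hαe A₁ hA₁ _hsol δ' _hδR _hδtr _hδQ
  have hFL' : (i.1.1.L : ℝ) = (L : ℝ) := (by exact_mod_cast i.2.1); have hL1 : (1 : ℝ) ≤ (L : ℝ) := (by exact_mod_cast hL.le)
  have hL3 : (3 : ℝ) ≤ (L : ℝ) := by rw [← hFL']; exact three_le_memberL i
  obtain ⟨s3, -⟩ := windows_of_W hL3 (hα L hL).le (hef L hL).le (hWe L hL) (hWε L hL)
  have hWe' : 10 ^ 9 * (i.1.1.L : ℝ) ^ 2 * ef L ≤ 1 := by rw [hFL']; exact hWe L hL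
  have hWε' : 10 ^ 12 * (i.1.1.L : ℝ) ^ 3 * α L ≤ 1 := by rw [hFL']; exact hWε L hL
  have hregα : RegPr i.1.1 i.1.2.1 i.1.2.2 (α L) U₀ := regPr_mono i.1.1 hαe hreg
  have hHB := h46₀ L hL i U₀ hregα
  have hα0 : 0 < α L := hα L hL; have he0 : 0 < ef L := hef L hL
  have hηpos : 0 < eta i.1.1 i.1.2.1 i.1.2.2 := T3SectALandauChart.eta_pos i.1.1 i.1.2.1 i.1.2.2
  have hb : 0 ≤ BH L * eta i.1.1 i.1.2.1 i.1.2.2 := mul_nonneg (hBH0 L hL) hηpos.le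
  -- (G20)∕Prop. 3-tw for the chart of record at the member: `QuadAnalytic (CmapTwS U₀) C₂ˢ (e·η∕2)`
  have hIn := inputs_CmapTwS (F := i.1.1) (h := i.2.2.le) hα0 he0 hWe' hWε' U₀ hregα hHB
  have hC := hIn.quadAnalytic
  have hC₂ : 0 ≤ 40 * (2 * (3 * (2 * ef L + 2700 * (i.1.1.L : ℝ) * α L))) / (ef L * eta i.1.1 i.1.2.1 i.1.2.2) ^ 2 := by positivity
  -- the contraction regime of (51) in η-form: `9·C₂ˢ·(B_H η)·(η ε′) = 9·(40M₀ˢ∕e²)·B_H·ε′`, `3ηε′ ≤ 2(eη∕4)`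
  have hq' : 9 * (40 * (2 * (3 * (2 * ef L + 2700 * (i.1.1.L : ℝ) * α L))) / (ef L * eta i.1.1 i.1.2.1 i.1.2.2) ^ 2)
      * (BH L * eta i.1.1 i.1.2.1 i.1.2.2) * (eta i.1.1 i.1.2.1 i.1.2.2 * ε' L) < 1 := by
    have hcalc : 9 * (40 * (2 * (3 * (2 * ef L + 2700 * (i.1.1.L : ℝ) * α L))) / (ef L * eta i.1.1 i.1.2.1 i.1.2.2) ^ 2)
        * (BH L * eta i.1.1 i.1.2.1 i.1.2.2) * (eta i.1.1 i.1.2.1 i.1.2.2 * ε' L) = 9 * (40 * (2 * (3 * (2 * ef L + 2700 * (i.1.1.L : ℝ) * α L))) / ef L ^ 2) * BH L * ε' L := by field_simp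
    rw [hcalc, hFL']; exact hq47 L hL
  have hR3 : 3 * (eta i.1.1 i.1.2.1 i.1.2.2 * ε' L) ≤ 2 * (ef L * eta i.1.1 i.1.2.1 i.1.2.2 / 4) := by
    nlinarith only [mul_le_mul_of_nonneg_left (hR6 L hL) hηpos.le, hηpos]
  -- Prop. 3's `C`-slot input for the (115)-level letter `C̃`: `QuadAnalytic C̃ C₂ᵣ (e∕2)` (in `(F.L : ℝ)` spelling), the Sect. C regime in the same spelling
  have hC' := (prop4Hyp_CmapTwS_conj_zeroJet (F := i.1.1) (h := i.2.2.le) hα0 he0 hWe' hWε' U₀ hregα).quadAnalytic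
  have hC₂' : 0 ≤ 40 * (2 * (3 * (2 * ef L + 2700 * (i.1.1.L : ℝ) * α L))) / ef L ^ 2 := by positivity
  have hq'' : 9 * (40 * (2 * (3 * (2 * ef L + 2700 * (i.1.1.L : ℝ) * α L))) / ef L ^ 2) * B₀ L * ε' L < 1 := by rw [hFL']; exact hq47₀ L hL
  have hR3' : 3 * ε' L ≤ ef L / 2 := by linarith only [hR6 L hL]
  have hwin : 4 * (40 * (2 * (3 * (2 * ef L + 2700 * (i.1.1.L : ℝ) * α L))) / ef L ^ 2) * B₀ L * ε' L ^ 2 ≤ εC L := by rw [hFL']; exact hwinC L hL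
  have hnest : 4 * (40 * (2 * (3 * (2 * ef L + 2700 * (i.1.1.L : ℝ) * α L))) / ef L ^ 2) * ε' L ^ 2
      ≤ 4 * (40 * (2 * (3 * (2 * ef L + 2700 * (i.1.1.L : ℝ) * α L))) / (ef L * eta i.1.1 i.1.2.1 i.1.2.2) ^ 2) * (eta i.1.1 i.1.2.1 i.1.2.2 * ε' L) ^ 2 := by
    apply le_of_eq; field_simp
  have hRC' := hRC L hL i U₀ hregα
  rw [← hFL'] at hRC'
  -- `‖H₁B̃‖ ≤ 2B₀α` from `norm_H₁` ∘ (20) and `L³·3L·ε₁ ≤ α`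
  have hwin2 : (i.1.1.L : ℝ) ^ 3 * ε₁ ≤ 1 / 2 := by rw [hFL']; exact (windows_of_admissible hL1 hε₁.le hαe s3).1
  have hclose' : CloseAvg i.1.1 i.1.2.1 i.1.2.2 i.2.2.le ((i.1.1.L : ℝ) ^ 3 * ε₁) V U₀ := by rw [hFL']; exact hclose
  have hB := bound20_symLog_of_closeAvg i.1.1 i.2.2.le hε₁ hwin2 V U₀ hclose'
  have hH₁B : ‖H1f i.1.1 i.1.2.1 i.1.2.2 i.2.2.le (c₀ L) (cB L) (a L i) (DeltaOnePJ i.1.1 i.1.2.1 i.1.2.2 i.2.2.le (c₀ L) (cB L) (a L i)) U₀ (fun c : PBond (i.1.1.P i.1.2.1) 0 =>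
          (-Complex.I) • mlog (((V c : Matrix.specialUnitaryGroup (Fin 2) ℂ) : Matrix (Fin 2) (Fin 2) ℂ)
            * star ((descendTo i.1.1 ℰp i.1.2.1 i.1.2.2 i.2.2.le U₀ c : Matrix.specialUnitaryGroup (Fin 2) ℂ) : Matrix (Fin 2) (Fin 2) ℂ)))‖ ≤ 2 * B₀ L * α L := by
    have h0 := norm_H₁ L hL i _ U₀ hreg hαe (fun c : PBond (i.1.1.P i.1.2.1) 0 =>
          (-Complex.I) • mlog (((V c : Matrix.specialUnitaryGroup (Fin 2) ℂ) : Matrix (Fin 2) (Fin 2) ℂ)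
            * star ((descendTo i.1.1 ℰp i.1.2.1 i.1.2.2 i.2.2.le U₀ c : Matrix.specialUnitaryGroup (Fin 2) ℂ) : Matrix (Fin 2) (Fin 2) ℂ)))
    have hB' : ‖(fun c : PBond (i.1.1.P i.1.2.1) 0 =>
          (-Complex.I) • mlog (((V c : Matrix.specialUnitaryGroup (Fin 2) ℂ) : Matrix (Fin 2) (Fin 2) ℂ)
            * star ((descendTo i.1.1 ℰp i.1.2.1 i.1.2.2 i.2.2.le U₀ c : Matrix.specialUnitaryGroup (Fin 2) ℂ) : Matrix (Fin 2) (Fin 2) ℂ)))‖ ≤ 2 * α L := by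
      have h3 : 2 * ((3 : ℝ) * i.1.1.L) * ((i.1.1.L : ℝ) ^ 3 * ε₁) = 2 * ((L : ℝ) ^ 3 * (3 * (L : ℝ)) * ε₁) := by rw [hFL']; ring
      rw [h3] at hB; linarith only [hB, hαe]
    calc _ ≤ B₀ L * _ := h0
      _ ≤ B₀ L * (2 * α L) := mul_le_mul_of_nonneg_left hB' (hB₀ L hL).le
      _ = 2 * B₀ L * α L := by ring
  -- sizes: `‖A′‖ < r + 2B₀α ≤ min (a₃, ε′∕2)`, `‖κ_f • ιA′‖ < η·ε′`
  have hA'n : ‖A₁ + H1f i.1.1 i.1.2.1 i.1.2.2 i.2.2.le (c₀ L) (cB L) (a L i) (DeltaOnePJ i.1.1 i.1.2.1 i.1.2.2 i.2.2.le (c₀ L) (cB L) (a L i)) U₀ (fun c : PBond (i.1.1.P i.1.2.1) 0 =>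
          (-Complex.I) • mlog (((V c : Matrix.specialUnitaryGroup (Fin 2) ℂ) : Matrix (Fin 2) (Fin 2) ℂ)
            * star ((descendTo i.1.1 ℰp i.1.2.1 i.1.2.2 i.2.2.le U₀ c : Matrix.specialUnitaryGroup (Fin 2) ℂ) : Matrix (Fin 2) (Fin 2) ℂ)))‖ < r L + 2 * B₀ L * α L := lt_of_le_of_lt (norm_add_le _ _) (add_lt_add_of_lt_of_le hA₁ hH₁B)
  have hr0 : 0 ≤ r L := (norm_nonneg A₁).trans hA₁.le
  have h2 : 0 ≤ 2 * B₀ L * α L := by have := (hB₀ L hL).le; positivity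
  have ha3 := lt_of_lt_of_le hA'n (show r L + 2 * B₀ L * α L ≤ a₃ L by linarith only [hrα L hL, hr4 L hL, hr0])
  have hAε' := lt_of_lt_of_le hA'n (show r L + 2 * B₀ L * α L ≤ ε' L by linarith only [hrε2 L hL, hr0, h2])
  have hnI : ‖(((eta i.1.1 i.1.2.1 i.1.2.2 : ℝ) : ℂ) * Complex.I)‖ = eta i.1.1 i.1.2.1 i.1.2.2 := by
    rw [norm_mul, Complex.norm_I, mul_one, Complex.norm_real, Real.norm_of_nonneg hηpos.le]
  have hsplit : ((fun b : PBond (i.1.1.P i.1.2.2) 0 => JetSup.equiv _ _ _ A₁ (bondEquiv i.1.1 i.1.2.2 b))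
        + (fun b : PBond (i.1.1.P i.1.2.2) 0 => JetSup.equiv _ _ _ (H1f i.1.1 i.1.2.1 i.1.2.2 i.2.2.le (c₀ L) (cB L) (a L i) (DeltaOnePJ i.1.1 i.1.2.1 i.1.2.2 i.2.2.le (c₀ L) (cB L) (a L i)) U₀ (fun c : PBond (i.1.1.P i.1.2.1) 0 =>
          (-Complex.I) • mlog (((V c : Matrix.specialUnitaryGroup (Fin 2) ℂ) : Matrix (Fin 2) (Fin 2) ℂ)
            * star ((descendTo i.1.1 ℰp i.1.2.1 i.1.2.2 i.2.2.le U₀ c : Matrix.specialUnitaryGroup (Fin 2) ℂ) : Matrix (Fin 2) (Fin 2) ℂ)))) (bondEquiv i.1.1 i.1.2.2 b)))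
      = fun b : PBond (i.1.1.P i.1.2.2) 0 => JetSup.equiv _ _ _ (A₁ + H1f i.1.1 i.1.2.1 i.1.2.2 i.2.2.le (c₀ L) (cB L) (a L i) (DeltaOnePJ i.1.1 i.1.2.1 i.1.2.2 i.2.2.le (c₀ L) (cB L) (a L i)) U₀ (fun c : PBond (i.1.1.P i.1.2.1) 0 =>
          (-Complex.I) • mlog (((V c : Matrix.specialUnitaryGroup (Fin 2) ℂ) : Matrix (Fin 2) (Fin 2) ℂ)
            * star ((descendTo i.1.1 ℰp i.1.2.1 i.1.2.2 i.2.2.le U₀ c : Matrix.specialUnitaryGroup (Fin 2) ℂ) : Matrix (Fin 2) (Fin 2) ℂ)))) (bondEquiv i.1.1 i.1.2.2 b) := by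
    funext b
    rfl
  have hA : ‖(((eta i.1.1 i.1.2.1 i.1.2.2 : ℝ) : ℂ) * Complex.I) • ((fun b : PBond (i.1.1.P i.1.2.2) 0 => JetSup.equiv _ _ _ A₁ (bondEquiv i.1.1 i.1.2.2 b))
        + (fun b : PBond (i.1.1.P i.1.2.2) 0 => JetSup.equiv _ _ _ (H1f i.1.1 i.1.2.1 i.1.2.2 i.2.2.le (c₀ L) (cB L) (a L i) (DeltaOnePJ i.1.1 i.1.2.1 i.1.2.2 i.2.2.le (c₀ L) (cB L) (a L i)) U₀ (fun c : PBond (i.1.1.P i.1.2.1) 0 =>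
          (-Complex.I) • mlog (((V c : Matrix.specialUnitaryGroup (Fin 2) ℂ) : Matrix (Fin 2) (Fin 2) ℂ)
            * star ((descendTo i.1.1 ℰp i.1.2.1 i.1.2.2 i.2.2.le U₀ c : Matrix.specialUnitaryGroup (Fin 2) ℂ) : Matrix (Fin 2) (Fin 2) ℂ)))) (bondEquiv i.1.1 i.1.2.2 b)))‖
      < eta i.1.1 i.1.2.1 i.1.2.2 * ε' L := by
    rw [hsplit, norm_smul, hnI]
    exact lt_of_le_of_lt (mul_le_mul_of_nonneg_left (norm_jetRead_le i.1.1 _) hηpos.le) (mul_lt_mul_of_pos_left hAε' hηpos)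
  exact eventually_smul_iota_T47_eq_chart_pinv i.1.1 i.1.2.1 i.1.2.2 i.2.2.le (c₀ L) (cB L) (a L i) U₀ hRC' hC hC₂ hb hHB hq' hR3 hC' hC₂' hq'' hR3' hwin hnest
    A₁ (H1f i.1.1 i.1.2.1 i.1.2.2 i.2.2.le (c₀ L) (cB L) (a L i) (DeltaOnePJ i.1.1 i.1.2.1 i.1.2.2 i.2.2.le (c₀ L) (cB L) (a L i)) U₀ (fun c : PBond (i.1.1.P i.1.2.1) 0 =>
          (-Complex.I) • mlog (((V c : Matrix.specialUnitaryGroup (Fin 2) ℂ) : Matrix (Fin 2) (Fin 2) ℂ)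
            * star ((descendTo i.1.1 ℰp i.1.2.1 i.1.2.2 i.2.2.le U₀ c : Matrix.specialUnitaryGroup (Fin 2) ℂ) : Matrix (Fin 2) (Fin 2) ℂ)))) δ' ha3 hAε' hA

/-! ## (v1.1) The same row with NO new numeric window: B13 radii at `ρ₀ := r + 2B₀α` -/

set_option maxHeartbeats 400000 in -- HEARTBEAT BUDGET rule (cell README): ~30-binder family context + (G22) reader rewrites; line-neutral, decl-local
/-- ★★★ **(v1.1) THE `hchart` ROW AT THE LETTERS OF RECORD WITHOUT `hwinC`**: as `hchart_family_at_record`, but ✓p679214 is run at the B13 radii `(ε′₁₁₅, ε) := (ρ₀, η·ρ₀)`,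
`ρ₀ := r L + 2·B₀ L·α L` (the radius the member point `A′ = A₁ + H₁B̃` actually has): then `9C₂·b·ρ₀ < 1` from `hq47`∕`hq47₀` + `hrε2` (`ρ₀ ≤ ε′∕2`), `3ρ₀ ≤ e∕2` from `hR6`,
the nesting window `4C₂ᵣB₀ρ₀² ≤ C₂ᵣB₀a₃² ≤ C₂ᵣB₀(εC + a₃)² ≤ εC` from `hrα hr4` (`ρ₀ ≤ 2r ≤ a₃∕2`) and the Sect. C regime's OWN numerals `hεC hselfC` (S16ᴰ∕S18ᴸ VERBATIM) — so S19 := S18ᴸ ∘ this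
displays NO new row.  Same conclusion VERBATIM. [cite: Balaban1985Variational, (44)-(49) p.285, (55) p.286, Prop. 3 p.289, (112) p.294, Prop. 6 p.295, (117)-(121) p.295; Balaban1985BackgroundPropagators, (3.126) p.420, (3.133) p.422; Balaban1988RG2Cluster, p.5] -/
theorem hchart_family_at_record_of_selfC
    [hFL : ∀ F : T3Family, Fact (0 < (F.L : ℝ))] [hFη : ∀ (F : T3Family) (k : ℕ), Fact (0 < ((F.L : ℝ)⁻¹) ^ k)]
    (B₀ a₃ α r : ℕ → ℝ) (hB₀ : ∀ L, 1 < L → 0 < B₀ L) (hα : ∀ L, 1 < L → 0 < α L)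
    (c₀ cB : ℕ → ℝ) [hc₀ : ∀ L : ℕ, Fact (0 < c₀ L)] [hcB : ∀ L : ℕ, Fact (0 < cB L)]
    (a : ∀ L : ℕ, Idx L → ℝ)
    (εC : ℕ → ℝ)
    (norm_H₁ : ∀ (L : ℕ), 1 < L → ∀ (i : Idx L) (ρ : ℝ) (U₀ : GaugeField (i.1.1.P i.1.2.2) 0 (Matrix.specialUnitaryGroup (Fin 2) ℂ)),
      RegPr i.1.1 i.1.2.1 i.1.2.2 ρ U₀ → ρ ≤ α L → ∀ b, ‖H1f i.1.1 i.1.2.1 i.1.2.2 i.2.2.le (c₀ L) (cB L) (a L i) (DeltaOnePJ i.1.1 i.1.2.1 i.1.2.2 i.2.2.le (c₀ L) (cB L) (a L i)) U₀ b‖ ≤ B₀ L * ‖b‖)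
    (hrα : ∀ L : ℕ, 1 < L → 2 * B₀ L * α L ≤ r L) (hr4 : ∀ L : ℕ, 1 < L → 4 * r L ≤ a₃ L)
    (BH : ℕ → ℝ) (hBH0 : ∀ L : ℕ, 1 < L → 0 ≤ BH L)
    (h46₀ : ∀ (L : ℕ), 1 < L → ∀ (i : Idx L) (U₀ : GaugeField (i.1.1.P i.1.2.2) 0 (Matrix.specialUnitaryGroup (Fin 2) ℂ)), RegPr i.1.1 i.1.2.1 i.1.2.2 (α L) U₀ →
      ∀ Y, ‖H46P i.1.1 i.1.2.1 i.1.2.2 i.2.2.le (c₀ L) (cB L) (a L i) U₀ Y‖ ≤ BH L * eta i.1.1 i.1.2.1 i.1.2.2 * ‖Y‖)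
    (ef : ℕ → ℝ) (hef : ∀ L, 1 < L → 0 < ef L)
    (hWe : ∀ L : ℕ, 1 < L → 10 ^ 9 * (L : ℝ) ^ 2 * ef L ≤ 1) (hWε : ∀ L : ℕ, 1 < L → 10 ^ 12 * (L : ℝ) ^ 3 * α L ≤ 1)
    (ε' : ℕ → ℝ) (hq47 : ∀ L : ℕ, 1 < L → 9 * (40 * (2 * (3 * (2 * ef L + 2700 * (L : ℝ) * α L))) / ef L ^ 2) * BH L * ε' L < 1)
    (hR6 : ∀ L : ℕ, 1 < L → 6 * ε' L ≤ ef L)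
    (hrε2 : ∀ L : ℕ, 1 < L → 2 * (r L + 2 * B₀ L * α L) ≤ ε' L)
    (hq47₀ : ∀ L : ℕ, 1 < L → 9 * (40 * (2 * (3 * (2 * ef L + 2700 * (L : ℝ) * α L))) / ef L ^ 2) * B₀ L * ε' L < 1)
    -- (v1.1) NO new window: the Sect. C regime's own numerals `hεC hselfC` (S16ᴰ∕S18ᴸ VERBATIM) replace `hwinC` once the B13 radii are taken at `ρ₀ := r + 2B₀α` (≤ `ε′∕2`, ≤ `a₃∕2`)
    (hεC : ∀ L : ℕ, 1 < L → 0 ≤ εC L)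
    (hselfC : ∀ L : ℕ, 1 < L → B₀ L * (40 * (2 * (3 * (2 * ef L + 2700 * (L : ℝ) * α L))) / ef L ^ 2) * (εC L + a₃ L) ^ 2 ≤ εC L)
    (hRC : ∀ (L : ℕ), 1 < L → ∀ (i : Idx L) (U₀ : GaugeField (i.1.1.P i.1.2.2) 0 (Matrix.specialUnitaryGroup (Fin 2) ℂ)), RegPr i.1.1 i.1.2.1 i.1.2.2 (α L) U₀ →
      Regime (H1f i.1.1 i.1.2.1 i.1.2.2 i.2.2.le (c₀ L) (cB L) (a L i) (DeltaPiSlotP i.1.1 i.1.2.1 i.1.2.2 i.2.2.le (c₀ L) (cB L) (a L i)) U₀) 0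
        (fun A' : Space115 (i.1.1.L : ℝ) (((i.1.1.L : ℝ)⁻¹) ^ (i.1.2.2 - i.1.2.1)) (fun _ : Bond 3 (periodsT3 i.1.1 i.1.2.2) => i.1.2.2 - i.1.2.1)
            (fun _ : Bond 3 (periodsT3 i.1.1 i.1.2.2) × Fin 3 => i.1.2.2 - i.1.2.1) (nabla115 (((i.1.1.L : ℝ)⁻¹) ^ (i.1.2.2 - i.1.2.1)) (bgOfCfg i.1.1 i.1.2.2 U₀)) =>
          (-Complex.I) • CmapTwS i.1.1 i.1.2.1 i.1.2.2 i.2.2.le U₀ (((((eta i.1.1 i.1.2.1 i.1.2.2 : ℝ) : ℂ)) * Complex.I) • (fun b : PBond (i.1.1.P i.1.2.2) 0 => JetSup.equiv _ _ _ A' (bondEquiv i.1.1 i.1.2.2 b))))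
        (B₀ L) 0 (40 * (2 * (3 * (2 * ef L + 2700 * (L : ℝ) * α L))) / ef L ^ 2) (ef L / 2) 0 (a₃ L) (εC L)) :
    ∀ (L : ℕ), 1 < L → ∀ (i : Idx L) (ε₁ : ℝ) (V : GaugeField (i.1.1.P i.1.2.1) 0 (Matrix.specialUnitaryGroup (Fin 2) ℂ))
      (U₀ : GaugeField (i.1.1.P i.1.2.2) 0 (Matrix.specialUnitaryGroup (Fin 2) ℂ)), 0 < ε₁ → PlaqSmall ε₁ V →
      RegPr i.1.1 i.1.2.1 i.1.2.2 ((L : ℝ) ^ 3 * (3 * (L : ℝ)) * ε₁) U₀ → CloseAvg i.1.1 i.1.2.1 i.1.2.2 i.2.2.le ((L : ℝ) ^ 3 * ε₁) V U₀ → (L : ℝ) ^ 3 * (3 * (L : ℝ)) * ε₁ ≤ α L →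
      ∀ A₁ : Space115 (i.1.1.L : ℝ) (((i.1.1.L : ℝ)⁻¹) ^ (i.1.2.2 - i.1.2.1)) (fun _ : Bond 3 (periodsT3 i.1.1 i.1.2.2) => i.1.2.2 - i.1.2.1)
          (fun _ : Bond 3 (periodsT3 i.1.1 i.1.2.2) × Fin 3 => i.1.2.2 - i.1.2.1) (nabla115 (((i.1.1.L : ℝ)⁻¹) ^ (i.1.2.2 - i.1.2.1)) (bgOfCfg i.1.1 i.1.2.2 U₀)),
        ‖A₁‖ < r L →
        A₁ + frakGfR i.1.1 i.1.2.1 i.1.2.2 i.2.2.le (c₀ L) (cB L) (a L i) (DeltaOnePJ i.1.1 i.1.2.1 i.1.2.2 i.2.2.le (c₀ L) (cB L) (a L i)) U₀ (Jcur (bgOfCfg i.1.1 i.1.2.2 U₀)) + frakGfR i.1.1 i.1.2.1 i.1.2.2 i.2.2.le (c₀ L) (cB L) (a L i) (DeltaOnePJ i.1.1 i.1.2.1 i.1.2.2 i.2.2.le (c₀ L) (cB L) (a L i)) U₀ (W80 (rieszτ frobEquiv) (LinearMap.toContinuousLinearMap (Matrix.traceLinearMap (Fin 2) ℂ ℂ))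 (bgOfCfg i.1.1 i.1.2.2 U₀) (H1f i.1.1 i.1.2.1 i.1.2.2 i.2.2.le (c₀ L) (cB L) (a L i) (DeltaPiSlotP i.1.1 i.1.2.1 i.1.2.2 i.2.2.le (c₀ L) (cB L) (a L i)) U₀)
            (fun A' => (-Complex.I) • CmapTwS i.1.1 i.1.2.1 i.1.2.2 i.2.2.le U₀ (((((eta i.1.1 i.1.2.1 i.1.2.2 : ℝ) : ℂ)) * Complex.I) • (fun b : PBond (i.1.1.P i.1.2.2) 0 => JetSup.equiv _ _ _ A' (bondEquiv i.1.1 i.1.2.2 b)))) (εC L) (Jcur (bgOfCfg i.1.1 i.1.2.2 U₀))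
            (currentCLM frobEquiv (fun _ : Bond 3 (periodsT3 i.1.1 i.1.2.2) × Fin 3 => i.1.2.2 - i.1.2.1) (nabla115 (((i.1.1.L : ℝ)⁻¹) ^ (i.1.2.2 - i.1.2.1)) (bgOfCfg i.1.1 i.1.2.2 U₀)) (DeltaEtaSlot i.1.1 i.1.2.1 i.1.2.2 (c₀ L) U₀)) (A₁ + H1f i.1.1 i.1.2.1 i.1.2.2 i.2.2.le (c₀ L) (cB L) (a L i) (DeltaOnePJ i.1.1 i.1.2.1 i.1.2.2 i.2.2.le (c₀ L) (cB L) (a L i)) U₀ (fun c : PBond (i.1.1.P i.1.2.1) 0 =>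
          (-Complex.I) • mlog (((V c : Matrix.specialUnitaryGroup (Fin 2) ℂ) : Matrix (Fin 2) (Fin 2) ℂ)
            * star ((descendTo i.1.1 ℰp i.1.2.1 i.1.2.2 i.2.2.le U₀ c : Matrix.specialUnitaryGroup (Fin 2) ℂ) : Matrix (Fin 2) (Fin 2) ℂ))))) = 0 →
        ∀ δ' : Space115 (i.1.1.L : ℝ) (((i.1.1.L : ℝ)⁻¹) ^ (i.1.2.2 - i.1.2.1)) (fun _ : Bond 3 (periodsT3 i.1.1 i.1.2.2) => i.1.2.2 - i.1.2.1)
          (fun _ : Bond 3 (periodsT3 i.1.1 i.1.2.2) × Fin 3 => i.1.2.2 - i.1.2.1) (nabla115 (((i.1.1.L : ℝ)⁻¹) ^ (i.1.2.2 - i.1.2.1)) (bgOfCfg i.1.1 i.1.2.2 U₀)),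
          (∀ b' : PBond (i.1.1.P i.1.2.2) 0, star (JetSup.equiv _ _ _ δ' (bondEquiv i.1.1 i.1.2.2 b')) = JetSup.equiv _ _ _ δ' (bondEquiv i.1.1 i.1.2.2 b')) →
          (∀ b' : PBond (i.1.1.P i.1.2.2) 0, Matrix.trace (JetSup.equiv _ _ _ δ' (bondEquiv i.1.1 i.1.2.2 b')) = 0) →
          QTwS i.1.1 i.1.2.1 i.1.2.2 i.2.2.le U₀ (fun b' : PBond (i.1.1.P i.1.2.2) 0 => JetSup.equiv _ _ _ δ' (bondEquiv i.1.1 i.1.2.2 b')) = 0 →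
          ∀ᶠ t : ℝ in nhds 0,
            (((eta i.1.1 i.1.2.1 i.1.2.2 : ℝ) : ℂ) * Complex.I) • (fun b' : PBond (i.1.1.P i.1.2.2) 0 => JetSup.equiv _ _ _ (T47 (H1f i.1.1 i.1.2.1 i.1.2.2 i.2.2.le (c₀ L) (cB L) (a L i) (DeltaPiSlotP i.1.1 i.1.2.1 i.1.2.2 i.2.2.le (c₀ L) (cB L) (a L i)) U₀)
            (fun A' => (-Complex.I) • CmapTwS i.1.1 i.1.2.1 i.1.2.2 i.2.2.le U₀ (((((eta i.1.1 i.1.2.1 i.1.2.2 : ℝ) : ℂ)) * Complex.I) • (fun b : PBond (i.1.1.P i.1.2.2) 0 => JetSup.equiv _ _ _ A' (bondEquiv i.1.1 i.1.2.2 b)))) (εC L) ((A₁ + H1f i.1.1 i.1.2.1 i.1.2.2 i.2.2.le (c₀ L) (cB L) (a L i) (DeltaOnePJ i.1.1 i.1.2.1 i.1.2.2 i.2.2.le (c₀ L) (cB L) (a L i)) U₀ (fun c : PBond (i.1.1.P i.1.2.1) 0 =>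
          (-Complex.I) • mlog (((V c : Matrix.specialUnitaryGroup (Fin 2) ℂ) : Matrix (Fin 2) (Fin 2) ℂ)
            * star ((descendTo i.1.1 ℰp i.1.2.1 i.1.2.2 i.2.2.le U₀ c : Matrix.specialUnitaryGroup (Fin 2) ℂ) : Matrix (Fin 2) (Fin 2) ℂ)))) + (t : ℂ) • δ')) (bondEquiv i.1.1 i.1.2.2 b'))
              = (((((eta i.1.1 i.1.2.1 i.1.2.2 : ℝ) : ℂ) * Complex.I) • ((fun b : PBond (i.1.1.P i.1.2.2) 0 => JetSup.equiv _ _ _ A₁ (bondEquiv i.1.1 i.1.2.2 b))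
              + (fun b : PBond (i.1.1.P i.1.2.2) 0 => JetSup.equiv _ _ _ (H1f i.1.1 i.1.2.1 i.1.2.2 i.2.2.le (c₀ L) (cB L) (a L i) (DeltaOnePJ i.1.1 i.1.2.1 i.1.2.2 i.2.2.le (c₀ L) (cB L) (a L i)) U₀ (fun c : PBond (i.1.1.P i.1.2.1) 0 =>
          (-Complex.I) • mlog (((V c : Matrix.specialUnitaryGroup (Fin 2) ℂ) : Matrix (Fin 2) (Fin 2) ℂ)
            * star ((descendTo i.1.1 ℰp i.1.2.1 i.1.2.2 i.2.2.le U₀ c : Matrix.specialUnitaryGroup (Fin 2) ℂ) : Matrix (Fin 2) (Fin 2) ℂ)))) (bondEquiv i.1.1 i.1.2.2 b)))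
                  + (t : ℂ) • ((((eta i.1.1 i.1.2.1 i.1.2.2 : ℝ) : ℂ) * Complex.I) • fun b' : PBond (i.1.1.P i.1.2.2) 0 => JetSup.equiv _ _ _ δ' (bondEquiv i.1.1 i.1.2.2 b')))
                - H46P i.1.1 i.1.2.1 i.1.2.2 i.2.2.le (c₀ L) (cB L) (a L i) U₀ (Dfix (CmapTwS i.1.1 i.1.2.1 i.1.2.2 i.2.2.le U₀) (H46P i.1.1 i.1.2.1 i.1.2.2 i.2.2.le (c₀ L) (cB L) (a L i) U₀) (40 * (2 * (3 * (2 * ef L + 2700 * (i.1.1.L : ℝ) * α L))) / (ef L * eta i.1.1 i.1.2.1 i.1.2.2) ^ 2)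
                    ((((eta i.1.1 i.1.2.1 i.1.2.2 : ℝ) : ℂ) * Complex.I) • ((fun b : PBond (i.1.1.P i.1.2.2) 0 => JetSup.equiv _ _ _ A₁ (bondEquiv i.1.1 i.1.2.2 b))
              + (fun b : PBond (i.1.1.P i.1.2.2) 0 => JetSup.equiv _ _ _ (H1f i.1.1 i.1.2.1 i.1.2.2 i.2.2.le (c₀ L) (cB L) (a L i) (DeltaOnePJ i.1.1 i.1.2.1 i.1.2.2 i.2.2.le (c₀ L) (cB L) (a L i)) U₀ (fun c : PBond (i.1.1.P i.1.2.1) 0 =>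
          (-Complex.I) • mlog (((V c : Matrix.specialUnitaryGroup (Fin 2) ℂ) : Matrix (Fin 2) (Fin 2) ℂ)
            * star ((descendTo i.1.1 ℰp i.1.2.1 i.1.2.2 i.2.2.le U₀ c : Matrix.specialUnitaryGroup (Fin 2) ℂ) : Matrix (Fin 2) (Fin 2) ℂ)))) (bondEquiv i.1.1 i.1.2.2 b)))
                  + (t : ℂ) • ((((eta i.1.1 i.1.2.1 i.1.2.2 : ℝ) : ℂ) * Complex.I) • fun b' : PBond (i.1.1.P i.1.2.2) 0 => JetSup.equiv _ _ _ δ' (bondEquiv i.1.1 i.1.2.2 b'))))) := by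
  intro L hL i ε₁ V U₀ hε₁ hV hreg hclose hαe A₁ hA₁ _hsol δ' _hδR _hδtr _hδQ
  have hFL' : (i.1.1.L : ℝ) = (L : ℝ) := (by exact_mod_cast i.2.1); have hL1 : (1 : ℝ) ≤ (L : ℝ) := (by exact_mod_cast hL.le)
  have hL3 : (3 : ℝ) ≤ (L : ℝ) := by rw [← hFL']; exact three_le_memberL i
  obtain ⟨s3, -⟩ := windows_of_W hL3 (hα L hL).le (hef L hL).le (hWe L hL) (hWε L hL)
  have hWe' : 10 ^ 9 * (i.1.1.L : ℝ) ^ 2 * ef L ≤ 1 := by rw [hFL']; exact hWe L hL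
  have hWε' : 10 ^ 12 * (i.1.1.L : ℝ) ^ 3 * α L ≤ 1 := by rw [hFL']; exact hWε L hL
  have hregα : RegPr i.1.1 i.1.2.1 i.1.2.2 (α L) U₀ := regPr_mono i.1.1 hαe hreg
  have hHB := h46₀ L hL i U₀ hregα
  have hα0 : 0 < α L := hα L hL; have he0 : 0 < ef L := hef L hL
  have hηpos : 0 < eta i.1.1 i.1.2.1 i.1.2.2 := T3SectALandauChart.eta_pos i.1.1 i.1.2.1 i.1.2.2
  have hb : 0 ≤ BH L * eta i.1.1 i.1.2.1 i.1.2.2 := mul_nonneg (hBH0 L hL) hηpos.le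
  -- the radius of the member point: `ρ₀ := r + 2B₀α`, `0 ≤ ρ₀ ≤ ε′∕2`, `ρ₀ ≤ 2r ≤ a₃∕2`
  have hr0 : 0 ≤ r L := (norm_nonneg A₁).trans hA₁.le; have h2 : 0 ≤ 2 * B₀ L * α L := (by have := (hB₀ L hL).le; positivity)
  have hρ0 : 0 ≤ r L + 2 * B₀ L * α L := add_nonneg hr0 h2
  have hρε : 2 * (r L + 2 * B₀ L * α L) ≤ ε' L := hrε2 L hL
  have hρa : 2 * (r L + 2 * B₀ L * α L) ≤ a₃ L := by linarith only [hrα L hL, hr4 L hL, hr0]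
  have hC₂r0 : 0 ≤ 40 * (2 * (3 * (2 * ef L + 2700 * (i.1.1.L : ℝ) * α L))) / ef L ^ 2 := by positivity
  -- (G20)∕Prop. 3-tw for the chart of record at the member: `QuadAnalytic (CmapTwS U₀) C₂ˢ (e·η∕2)`
  have hC := (inputs_CmapTwS (F := i.1.1) (h := i.2.2.le) hα0 he0 hWe' hWε' U₀ hregα hHB).quadAnalytic
  have hC₂ : 0 ≤ 40 * (2 * (3 * (2 * ef L + 2700 * (i.1.1.L : ℝ) * α L))) / (ef L * eta i.1.1 i.1.2.1 i.1.2.2) ^ 2 := by positivity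
  -- the two (51)-windows at radius `ρ₀`: `9·C₂·b·ρ₀ ≤ ½·(9·C₂·b·ε′) < 1`
  have hq0 : 9 * (40 * (2 * (3 * (2 * ef L + 2700 * (i.1.1.L : ℝ) * α L))) / ef L ^ 2) * BH L * ε' L < 1 := by rw [hFL']; exact hq47 L hL
  have hq' : 9 * (40 * (2 * (3 * (2 * ef L + 2700 * (i.1.1.L : ℝ) * α L))) / (ef L * eta i.1.1 i.1.2.1 i.1.2.2) ^ 2)
      * (BH L * eta i.1.1 i.1.2.1 i.1.2.2) * (eta i.1.1 i.1.2.1 i.1.2.2 * (r L + 2 * B₀ L * α L)) < 1 := by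
    have hcalc : 9 * (40 * (2 * (3 * (2 * ef L + 2700 * (i.1.1.L : ℝ) * α L))) / (ef L * eta i.1.1 i.1.2.1 i.1.2.2) ^ 2)
        * (BH L * eta i.1.1 i.1.2.1 i.1.2.2) * (eta i.1.1 i.1.2.1 i.1.2.2 * (r L + 2 * B₀ L * α L))
        = 9 * (40 * (2 * (3 * (2 * ef L + 2700 * (i.1.1.L : ℝ) * α L))) / ef L ^ 2) * BH L * (r L + 2 * B₀ L * α L) := by field_simp
    rw [hcalc]
    have hm : 0 ≤ 9 * (40 * (2 * (3 * (2 * ef L + 2700 * (i.1.1.L : ℝ) * α L))) / ef L ^ 2) * BH L := by have := hBH0 L hL; positivity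
    nlinarith only [hm, hq0, hρε, hρ0, mul_le_mul_of_nonneg_left hρε hm]
  have hR3 : 3 * (eta i.1.1 i.1.2.1 i.1.2.2 * (r L + 2 * B₀ L * α L)) ≤ 2 * (ef L * eta i.1.1 i.1.2.1 i.1.2.2 / 4) := by
    nlinarith only [mul_le_mul_of_nonneg_left (hR6 L hL) hηpos.le, mul_le_mul_of_nonneg_left hρε hηpos.le, mul_nonneg hηpos.le he0.le]
  have hC' := (prop4Hyp_CmapTwS_conj_zeroJet (F := i.1.1) (h := i.2.2.le) hα0 he0 hWe' hWε' U₀ hregα).quadAnalytic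
  have hq'' : 9 * (40 * (2 * (3 * (2 * ef L + 2700 * (i.1.1.L : ℝ) * α L))) / ef L ^ 2) * B₀ L * (r L + 2 * B₀ L * α L) < 1 := by
    have hq1 : 9 * (40 * (2 * (3 * (2 * ef L + 2700 * (i.1.1.L : ℝ) * α L))) / ef L ^ 2) * B₀ L * ε' L < 1 := by rw [hFL']; exact hq47₀ L hL
    have hm : 0 ≤ 9 * (40 * (2 * (3 * (2 * ef L + 2700 * (i.1.1.L : ℝ) * α L))) / ef L ^ 2) * B₀ L := by have := (hB₀ L hL).le; positivity
    nlinarith only [hm, hq1, hρε, hρ0, mul_le_mul_of_nonneg_left hρε hm]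
  have hR3' : 3 * (r L + 2 * B₀ L * α L) ≤ ef L / 2 := by linarith only [hR6 L hL, hρε, he0.le]
  -- the nesting window from the Sect. C regime's own numerals: `4C₂ᵣB₀ρ₀² ≤ C₂ᵣB₀a₃² ≤ C₂ᵣB₀(εC + a₃)² ≤ εC`
  have hwin : 4 * (40 * (2 * (3 * (2 * ef L + 2700 * (i.1.1.L : ℝ) * α L))) / ef L ^ 2) * B₀ L * (r L + 2 * B₀ L * α L) ^ 2 ≤ εC L := by
    have hs : B₀ L * (40 * (2 * (3 * (2 * ef L + 2700 * (i.1.1.L : ℝ) * α L))) / ef L ^ 2) * (εC L + a₃ L) ^ 2 ≤ εC L := by rw [hFL']; exact hselfC L hL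
    have hm : 0 ≤ (40 * (2 * (3 * (2 * ef L + 2700 * (i.1.1.L : ℝ) * α L))) / ef L ^ 2) * B₀ L := mul_nonneg hC₂r0 (hB₀ L hL).le
    have hsq : 4 * (r L + 2 * B₀ L * α L) ^ 2 ≤ (εC L + a₃ L) ^ 2 := by nlinarith only [hρa, hρ0, hεC L hL]
    nlinarith only [hs, hm, hsq, mul_le_mul_of_nonneg_left hsq hm]
  have hnest : 4 * (40 * (2 * (3 * (2 * ef L + 2700 * (i.1.1.L : ℝ) * α L))) / ef L ^ 2) * (r L + 2 * B₀ L * α L) ^ 2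
      ≤ 4 * (40 * (2 * (3 * (2 * ef L + 2700 * (i.1.1.L : ℝ) * α L))) / (ef L * eta i.1.1 i.1.2.1 i.1.2.2) ^ 2) * (eta i.1.1 i.1.2.1 i.1.2.2 * (r L + 2 * B₀ L * α L)) ^ 2 := by
    apply le_of_eq; field_simp
  have hRC' := hRC L hL i U₀ hregα
  rw [← hFL'] at hRC'
  -- `‖H₁B̃‖ ≤ 2B₀α` from `norm_H₁` ∘ (20) and `L³·3L·ε₁ ≤ α`
  have hwin2 : (i.1.1.L : ℝ) ^ 3 * ε₁ ≤ 1 / 2 := by rw [hFL']; exact (windows_of_admissible hL1 hε₁.le hαe s3).1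
  have hclose' : CloseAvg i.1.1 i.1.2.1 i.1.2.2 i.2.2.le ((i.1.1.L : ℝ) ^ 3 * ε₁) V U₀ := by rw [hFL']; exact hclose
  have hB := bound20_symLog_of_closeAvg i.1.1 i.2.2.le hε₁ hwin2 V U₀ hclose'
  have hH₁B : ‖H1f i.1.1 i.1.2.1 i.1.2.2 i.2.2.le (c₀ L) (cB L) (a L i) (DeltaOnePJ i.1.1 i.1.2.1 i.1.2.2 i.2.2.le (c₀ L) (cB L) (a L i)) U₀ (fun c : PBond (i.1.1.P i.1.2.1) 0 =>
          (-Complex.I) • mlog (((V c : Matrix.specialUnitaryGroup (Fin 2) ℂ) : Matrix (Fin 2) (Fin 2) ℂ)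
            * star ((descendTo i.1.1 ℰp i.1.2.1 i.1.2.2 i.2.2.le U₀ c : Matrix.specialUnitaryGroup (Fin 2) ℂ) : Matrix (Fin 2) (Fin 2) ℂ)))‖ ≤ 2 * B₀ L * α L := by
    have h0 := norm_H₁ L hL i _ U₀ hreg hαe (fun c : PBond (i.1.1.P i.1.2.1) 0 =>
          (-Complex.I) • mlog (((V c : Matrix.specialUnitaryGroup (Fin 2) ℂ) : Matrix (Fin 2) (Fin 2) ℂ)
            * star ((descendTo i.1.1 ℰp i.1.2.1 i.1.2.2 i.2.2.le U₀ c : Matrix.specialUnitaryGroup (Fin 2) ℂ) : Matrix (Fin 2) (Fin 2) ℂ)))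
    have hB' : ‖(fun c : PBond (i.1.1.P i.1.2.1) 0 =>
          (-Complex.I) • mlog (((V c : Matrix.specialUnitaryGroup (Fin 2) ℂ) : Matrix (Fin 2) (Fin 2) ℂ)
            * star ((descendTo i.1.1 ℰp i.1.2.1 i.1.2.2 i.2.2.le U₀ c : Matrix.specialUnitaryGroup (Fin 2) ℂ) : Matrix (Fin 2) (Fin 2) ℂ)))‖ ≤ 2 * α L := by
      have h3 : 2 * ((3 : ℝ) * i.1.1.L) * ((i.1.1.L : ℝ) ^ 3 * ε₁) = 2 * ((L : ℝ) ^ 3 * (3 * (L : ℝ)) * ε₁) := by rw [hFL']; ring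
      rw [h3] at hB; linarith only [hB, hαe]
    calc _ ≤ B₀ L * _ := h0
      _ ≤ B₀ L * (2 * α L) := mul_le_mul_of_nonneg_left hB' (hB₀ L hL).le
      _ = 2 * B₀ L * α L := by ring
  -- sizes: `‖A′‖ < ρ₀ ≤ a₃`, `‖κ_f • ιA′‖ < η·ρ₀`
  have hA'n : ‖A₁ + H1f i.1.1 i.1.2.1 i.1.2.2 i.2.2.le (c₀ L) (cB L) (a L i) (DeltaOnePJ i.1.1 i.1.2.1 i.1.2.2 i.2.2.le (c₀ L) (cB L) (a L i)) U₀ (fun c : PBond (i.1.1.P i.1.2.1) 0 =>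
          (-Complex.I) • mlog (((V c : Matrix.specialUnitaryGroup (Fin 2) ℂ) : Matrix (Fin 2) (Fin 2) ℂ)
            * star ((descendTo i.1.1 ℰp i.1.2.1 i.1.2.2 i.2.2.le U₀ c : Matrix.specialUnitaryGroup (Fin 2) ℂ) : Matrix (Fin 2) (Fin 2) ℂ)))‖ < r L + 2 * B₀ L * α L := lt_of_le_of_lt (norm_add_le _ _) (add_lt_add_of_lt_of_le hA₁ hH₁B)
  have ha3 := lt_of_lt_of_le hA'n (show r L + 2 * B₀ L * α L ≤ a₃ L by linarith only [hρa, hρ0])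
  have hnI : ‖(((eta i.1.1 i.1.2.1 i.1.2.2 : ℝ) : ℂ) * Complex.I)‖ = eta i.1.1 i.1.2.1 i.1.2.2 := by
    rw [norm_mul, Complex.norm_I, mul_one, Complex.norm_real, Real.norm_of_nonneg hηpos.le]
  have hsplit : ((fun b : PBond (i.1.1.P i.1.2.2) 0 => JetSup.equiv _ _ _ A₁ (bondEquiv i.1.1 i.1.2.2 b))
        + (fun b : PBond (i.1.1.P i.1.2.2) 0 => JetSup.equiv _ _ _ (H1f i.1.1 i.1.2.1 i.1.2.2 i.2.2.le (c₀ L) (cB L) (a L i) (DeltaOnePJ i.1.1 i.1.2.1 i.1.2.2 i.2.2.le (c₀ L) (cB L) (a L i)) U₀ (fun c : PBond (i.1.1.P i.1.2.1) 0 =>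
          (-Complex.I) • mlog (((V c : Matrix.specialUnitaryGroup (Fin 2) ℂ) : Matrix (Fin 2) (Fin 2) ℂ)
            * star ((descendTo i.1.1 ℰp i.1.2.1 i.1.2.2 i.2.2.le U₀ c : Matrix.specialUnitaryGroup (Fin 2) ℂ) : Matrix (Fin 2) (Fin 2) ℂ)))) (bondEquiv i.1.1 i.1.2.2 b)))
      = fun b : PBond (i.1.1.P i.1.2.2) 0 => JetSup.equiv _ _ _ (A₁ + H1f i.1.1 i.1.2.1 i.1.2.2 i.2.2.le (c₀ L) (cB L) (a L i) (DeltaOnePJ i.1.1 i.1.2.1 i.1.2.2 i.2.2.le (c₀ L) (cB L) (a L i)) U₀ (fun c : PBond (i.1.1.P i.1.2.1) 0 =>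
          (-Complex.I) • mlog (((V c : Matrix.specialUnitaryGroup (Fin 2) ℂ) : Matrix (Fin 2) (Fin 2) ℂ)
            * star ((descendTo i.1.1 ℰp i.1.2.1 i.1.2.2 i.2.2.le U₀ c : Matrix.specialUnitaryGroup (Fin 2) ℂ) : Matrix (Fin 2) (Fin 2) ℂ)))) (bondEquiv i.1.1 i.1.2.2 b) := by
    funext b
    rfl
  have hA : ‖(((eta i.1.1 i.1.2.1 i.1.2.2 : ℝ) : ℂ) * Complex.I) • ((fun b : PBond (i.1.1.P i.1.2.2) 0 => JetSup.equiv _ _ _ A₁ (bondEquiv i.1.1 i.1.2.2 b))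
        + (fun b : PBond (i.1.1.P i.1.2.2) 0 => JetSup.equiv _ _ _ (H1f i.1.1 i.1.2.1 i.1.2.2 i.2.2.le (c₀ L) (cB L) (a L i) (DeltaOnePJ i.1.1 i.1.2.1 i.1.2.2 i.2.2.le (c₀ L) (cB L) (a L i)) U₀ (fun c : PBond (i.1.1.P i.1.2.1) 0 =>
          (-Complex.I) • mlog (((V c : Matrix.specialUnitaryGroup (Fin 2) ℂ) : Matrix (Fin 2) (Fin 2) ℂ)
            * star ((descendTo i.1.1 ℰp i.1.2.1 i.1.2.2 i.2.2.le U₀ c : Matrix.specialUnitaryGroup (Fin 2) ℂ) : Matrix (Fin 2) (Fin 2) ℂ)))) (bondEquiv i.1.1 i.1.2.2 b)))‖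
      < eta i.1.1 i.1.2.1 i.1.2.2 * (r L + 2 * B₀ L * α L) := by
    rw [hsplit, norm_smul, hnI]
    exact lt_of_le_of_lt (mul_le_mul_of_nonneg_left (norm_jetRead_le i.1.1 _) hηpos.le) (mul_lt_mul_of_pos_left hA'n hηpos)
  exact eventually_smul_iota_T47_eq_chart_pinv i.1.1 i.1.2.1 i.1.2.2 i.2.2.le (c₀ L) (cB L) (a L i) U₀ hRC' hC hC₂ hb hHB hq' hR3 hC' hC₂r0 hq'' hR3' hwin hnest
    A₁ (H1f i.1.1 i.1.2.1 i.1.2.2 i.2.2.le (c₀ L) (cB L) (a L i) (DeltaOnePJ i.1.1 i.1.2.1 i.1.2.2 i.2.2.le (c₀ L) (cB L) (a L i)) U₀ (fun c : PBond (i.1.1.P i.1.2.1) 0 =>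
          (-Complex.I) • mlog (((V c : Matrix.specialUnitaryGroup (Fin 2) ℂ) : Matrix (Fin 2) (Fin 2) ℂ)
            * star ((descendTo i.1.1 ℰp i.1.2.1 i.1.2.2 i.2.2.le U₀ c : Matrix.specialUnitaryGroup (Fin 2) ℂ) : Matrix (Fin 2) (Fin 2) ℂ)))) δ' ha3 hA'n hA

end Summit.QuantumFields.YangMills.Theorems.Prop7HChartFamilyAtRecord

end
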